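import Summits.Ventures.CertifiedManyBodySolver.Observables.StructureFactorsPositivity
import Literature.MathematicalPhysics.QuantumLattice.HubbardNNNHoppingPairCorrelatorCertificate

/-!
# M3 observables (iii), `Sᶻ` channel: `W^z_r = Σ_x Sᶻ_x Sᶻ_{x+r}`, `C_zz(r; ψ)`, `S_zz(q; ψ)` on the
# `L × L` Hubbard torus, every `L`

HONEST FRAMING: first certified bounds; not a superconductivity verdict; every number
certified or labelled float.  OBJECTS and exact IDENTITIES only — no bound on any Hubbard ground
state is claimed here.

Companion of `Observables/StructureFactors.lean` (full `SU(2)` channel `W_r`, `S_s(q)`) for the cell's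
`Szz.q*` / `szsz_rr` rows (M3.md §4, R-M3-13: `M3.Szz.qpi_pi.{tp0,tpm1o4}.4x4N14` is a FIRST-ROWS kind;
speedrun `mbsolver`, request M3-L1, seat sr-mbsolver-m3-7).  The `SᶻSᶻ` words are diagonal in the
occupation basis (`Sᶻ_x = ½(n_{x↑} − n_{x↓})`), hence the cheapest structure-factor objective of a
reduced-density-matrix certificate; in an `SU(2)`-invariant STATE `S_zz = S_s / 3`, but no such relation
holds at the operator level, so the channel gets its own objects:

* `szCorrSum L r = W^z_r = Σ_x Sᶻ_x Sᶻ_{x+r}`, `szCorr L r ψ = C_zz(r; ψ) = Re ⟨ψ, W^z_r ψ⟩ / L²`;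
* `szStructureOp L k = 𝓢_zz(q) = Σ_{x,y} e^{iq·x} e^{-iq·y} Sᶻ_x Sᶻ_y`, `szStructureFactor L k ψ = S_zz(q; ψ)`;
* `szCorrSum_neg` (`W^z_{-r} = W^z_r`), `szStructureOp_eq_sum_smul_szCorrSum`, `szStructureOp_eq_sum_re_smul`,
  **`szStructureFactor_eq_sum_cos_mul_szCorr`: `S_zz(q; ψ) = Σ_r cos(2π (k·r)/L) C_zz(r; ψ)`**;
* `szStructureOp_eq_waves`: `𝓢_zz(q) = Tᶻ(q) Tᶻ(q)ᴴ` (`spinWaveZ` of `StructureFactorsPositivity`), hence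
  `szStructureFactor_nonneg : 0 ≤ S_zz(q; ψ)` and `spinStructureOp_eq_pm_add_sz`:
  `𝓢_s(q) = ½(T⁺T⁺ᴴ + T⁻T⁻ᴴ) + 𝓢_zz(q)`, so `S_zz(q; ψ) ≤ S_s(q; ψ)` (`szStructureFactor_le_spinStructureFactor`);
* `szCorr_eq_re_orbitState`: `C_zz(r; ψ) = Re ω̄_ψ(Sᶻ_0 Sᶻ_r)` in the translation-averaged vector state
  `orbitState (spaceGroupUnitary {1}) ψ` of the window-certificate consumers, and the window-objective
  reading `re_orbitState_toTorusEmb_sum_sZAt_mul`.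
Hirsch, PRB 31 (1985) 4403, eq. (4.7) (`S(q)` defined with `(n_{i↑} − n_{i↓})`, i.e. `4 S_zz`).
-/

noncomputable section

namespace Summit.Ventures.CertifiedManyBodySolver.Observables

open Matrix Literature.MathematicalPhysics.QuantumLattice Literature.Probability.LatticeModels
open Literature.MathematicalPhysics.QuantumLattice.HubbardWave0
open Literature.MathematicalPhysics.QuantumLattice.FermionTorus
open Literature.MathematicalPhysics.QuantumManyBody.StateRelaxation
open scoped BigOperators ComplexConjugate

/-! ## `Sᶻ_x Sᶻ_y = Sᶻ_y Sᶻ_x` -/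

section Local

variable {Λ : Type*} [LinearOrder Λ] [Fintype Λ]

/-- Local `Sᶻ` operators commute (both diagonal in the occupation basis). -/
theorem fermionSpinZ_commute (x y : Λ) : Commute (fermionSpinZ x) (fermionSpinZ y) := by
  have h : ∀ σ τ : Fin 2, Commute (numberOp x σ) (numberOp y τ) := fun σ τ =>
    numberAt_commute (orb x σ) (orb y τ)
  rw [fermionSpinZ_def, fermionSpinZ_def]
  exact (((h 0 0).sub_right (h 0 1)).sub_left ((h 1 0).sub_right (h 1 1))).smul_left _ |>.smul_right _

end Local

/-! ## Torus objects -/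

section Torus

variable (L : ℕ) [NeZero L]

/-- **`W^z_r = Σ_x Sᶻ_x Sᶻ_{x+r}`**. Hirsch 1985 eq. (4.7); M3.md §4 (`szsz_rr`). -/
def szCorrSum (r : TorusSite 2 L) :
    Matrix (Finset (Orb (FermionTorus 2 L))) (Finset (Orb (FermionTorus 2 L))) ℂ :=
  ∑ x : TorusSite 2 L, fermionSpinZ (ofTorusSite x) * fermionSpinZ (ofTorusSite (x + r))

/-- **`C_zz(r; ψ) = Re ⟨ψ, W^z_r ψ⟩ / L²`**, the per-site `SᶻSᶻ` correlator of a torus vector. -/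
def szCorr (r : TorusSite 2 L) (ψ : Fock (Orb (FermionTorus 2 L))) : ℝ :=
  (expect (szCorrSum L r) ψ).re / (L : ℝ) ^ 2

/-- **`𝓢_zz(q) = Σ_{x,y} e^{iq·x} e^{-iq·y} Sᶻ_x Sᶻ_y`** at `q = 2πk/L`. -/
def szStructureOp (k : TorusSite 2 L) :
    Matrix (Finset (Orb (FermionTorus 2 L))) (Finset (Orb (FermionTorus 2 L))) ℂ :=
  ∑ x : TorusSite 2 L, ∑ y : TorusSite 2 L,
    (blochPhase L k x * star (blochPhase L k y)) • (fermionSpinZ (ofTorusSite x) * fermionSpinZ (ofTorusSite y))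

/-- **`S_zz(q; ψ) = Re ⟨ψ, 𝓢_zz(q) ψ⟩ / L²`** (row ids `Szz.q<label>`). -/
def szStructureFactor (k : TorusSite 2 L) (ψ : Fock (Orb (FermionTorus 2 L))) : ℝ :=
  (expect (szStructureOp L k) ψ).re / (L : ℝ) ^ 2

/-- **`W^z_{-r} = W^z_r`** (reindex; the `Sᶻ` commute). -/
theorem szCorrSum_neg (r : TorusSite 2 L) : szCorrSum L (-r) = szCorrSum L r := by
  unfold szCorrSum
  conv_lhs => rw [← Equiv.sum_comp (Equiv.addRight r)]
  refine Fintype.sum_congr _ _ fun x => ?_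
  rw [Equiv.coe_addRight, add_neg_cancel_right, (fermionSpinZ_commute _ _).eq]

/-- **`𝓢_zz(q) = Σ_r e^{-iq·r} W^z_r`**. -/
theorem szStructureOp_eq_sum_smul_szCorrSum (k : TorusSite 2 L) :
    szStructureOp L k = ∑ r : TorusSite 2 L, star (blochPhase L k r) • szCorrSum L r := by
  have h : ∀ x : TorusSite 2 L,
      ∑ y : TorusSite 2 L, (blochPhase L k x * star (blochPhase L k y)) •
          (fermionSpinZ (ofTorusSite x) * fermionSpinZ (ofTorusSite y)) =
        ∑ r : TorusSite 2 L, star (blochPhase L k r) •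
          (fermionSpinZ (ofTorusSite x) * fermionSpinZ (ofTorusSite (x + r))) := by
    intro x
    rw [← Equiv.sum_comp (Equiv.addLeft x)]
    refine Fintype.sum_congr _ _ fun r => ?_
    rw [Equiv.coe_addLeft, blochPhase_add, star_mul', ← mul_assoc, blochPhase_mul_star_self, one_mul]
  calc szStructureOp L k
      = ∑ x : TorusSite 2 L, ∑ r : TorusSite 2 L, star (blochPhase L k r) •
          (fermionSpinZ (ofTorusSite x) * fermionSpinZ (ofTorusSite (x + r))) :=
        Finset.sum_congr rfl fun x _ => h x
    _ = ∑ r : TorusSite 2 L, ∑ x : TorusSite 2 L, star (blochPhase L k r) •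
          (fermionSpinZ (ofTorusSite x) * fermionSpinZ (ofTorusSite (x + r))) := Finset.sum_comm
    _ = ∑ r : TorusSite 2 L, star (blochPhase L k r) • szCorrSum L r := by
        simp only [szCorrSum, Finset.smul_sum]

/-- **Generic Fourier-to-cosine step** (public form of the one in `StructureFactors`): from
`A = Σ_r e^{-iq·r} B_r` and `B_{-r} = B_r`, `A = Σ_r cos(q·r) B_r`. -/
theorem eq_sum_re_blochPhase_smul
    {A : Matrix (Finset (Orb (FermionTorus 2 L))) (Finset (Orb (FermionTorus 2 L))) ℂ}
    {B : TorusSite 2 L → Matrix (Finset (Orb (FermionTorus 2 L))) (Finset (Orb (FermionTorus 2 L))) ℂ}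
    (k : TorusSite 2 L) (hA : A = ∑ r : TorusSite 2 L, star (blochPhase L k r) • B r)
    (hB : ∀ r, B (-r) = B r) :
    A = ∑ r : TorusSite 2 L, (((blochPhase L k r).re : ℝ) : ℂ) • B r := by
  have hφ : ∀ r : TorusSite 2 L,
      blochPhase L k r + star (blochPhase L k r) = (2 : ℂ) * (((blochPhase L k r).re : ℝ) : ℂ) := fun r => by
    rw [Complex.star_def, Complex.add_conj]
    push_cast
    ring
  have h2 : A = ∑ r : TorusSite 2 L, blochPhase L k r • B r := by
    rw [hA, ← Equiv.sum_comp (Equiv.neg (TorusSite 2 L))]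
    refine Fintype.sum_congr _ _ fun r => ?_
    rw [Equiv.neg_apply, blochPhase_neg, star_star, hB]
  have h3 : (2 : ℂ) • A = (2 : ℂ) • ∑ r : TorusSite 2 L, (((blochPhase L k r).re : ℝ) : ℂ) • B r :=
    calc (2 : ℂ) • A = A + A := two_smul _ _
      _ = (∑ r : TorusSite 2 L, blochPhase L k r • B r) +
            ∑ r : TorusSite 2 L, star (blochPhase L k r) • B r := by rw [← h2, ← hA]
      _ = ∑ r : TorusSite 2 L, (blochPhase L k r + star (blochPhase L k r)) • B r := by
          rw [← Finset.sum_add_distrib]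
          simp only [add_smul]
      _ = ∑ r : TorusSite 2 L, (2 : ℂ) • ((((blochPhase L k r).re : ℝ) : ℂ) • B r) :=
          Finset.sum_congr rfl fun r _ => by rw [hφ, mul_smul]
      _ = (2 : ℂ) • ∑ r : TorusSite 2 L, (((blochPhase L k r).re : ℝ) : ℂ) • B r := Finset.smul_sum.symm
  exact smul_right_injective _ two_ne_zero h3

/-- **`𝓢_zz(q) = Σ_r cos(2π (k·r)/L) W^z_r`**. -/
theorem szStructureOp_eq_sum_re_smul (k : TorusSite 2 L) :
    szStructureOp L k = ∑ r : TorusSite 2 L, (((blochPhase L k r).re : ℝ) : ℂ) • szCorrSum L r :=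
  eq_sum_re_blochPhase_smul L k (szStructureOp_eq_sum_smul_szCorrSum L k) (szCorrSum_neg L)

/-- `⟨ψ, 𝓢_zz(q) ψ⟩ = Σ_r cos(q·r) ⟨ψ, W^z_r ψ⟩`. -/
theorem expect_szStructureOp (k : TorusSite 2 L) (ψ : Fock (Orb (FermionTorus 2 L))) :
    expect (szStructureOp L k) ψ =
      ∑ r : TorusSite 2 L, (((blochPhase L k r).re : ℝ) : ℂ) * expect (szCorrSum L r) ψ := by
  rw [szStructureOp_eq_sum_re_smul, expect_sum]
  exact Finset.sum_congr rfl fun r _ => expect_smul _ _ _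

/-- **`S_zz(q; ψ) = Σ_r cos(2π (k·r)/L) · C_zz(r; ψ)`**. -/
theorem szStructureFactor_eq_sum_cos_mul_szCorr (k : TorusSite 2 L) (ψ : Fock (Orb (FermionTorus 2 L))) :
    szStructureFactor L k ψ =
      ∑ r : TorusSite 2 L, Real.cos (2 * Real.pi * ((torusDot L k r).val : ℝ) / L) * szCorr L r ψ := by
  unfold szStructureFactor szCorr
  rw [expect_szStructureOp, Complex.re_sum, Finset.sum_div]
  refine Finset.sum_congr rfl fun r _ => ?_
  rw [Complex.re_ofReal_mul, re_blochPhase, mul_div_assoc]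

/-! ### Gram form, positivity, and `S_zz ≤ S_s` -/

/-- **`𝓢_zz(q) = Tᶻ(q) Tᶻ(q)ᴴ`**. -/
theorem szStructureOp_eq_waves (k : TorusSite 2 L) :
    szStructureOp L k = spinWaveZ L k * (spinWaveZ L k)ᴴ := by
  rw [conjTranspose_spinWaveZ, spinWaveZ, Finset.sum_mul_sum, szStructureOp]
  refine Finset.sum_congr rfl fun x _ => Finset.sum_congr rfl fun y _ => ?_
  rw [smul_mul_smul_comm]

/-- **`𝓢_s(q) = ½ (T⁺T⁺ᴴ + T⁻T⁻ᴴ) + 𝓢_zz(q)`**. -/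
theorem spinStructureOp_eq_pm_add_sz (k : TorusSite 2 L) :
    spinStructureOp L k =
      (1 / 2 : ℂ) • (spinWavePlus L k * (spinWavePlus L k)ᴴ + spinWaveMinus L k * (spinWaveMinus L k)ᴴ) +
        szStructureOp L k := by
  rw [szStructureOp_eq_waves, spinStructureOp_eq_waves]

/-- **`0 ≤ S_zz(q; ψ)`** for every `q`, `ψ` (a-priori edge of the one-sided `Szz.q*` rows). -/
theorem szStructureFactor_nonneg (k : TorusSite 2 L) (ψ : Fock (Orb (FermionTorus 2 L))) :
    0 ≤ szStructureFactor L k ψ := by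
  open scoped ComplexOrder in
  have hnum : 0 ≤ (expect (szStructureOp L k) ψ).re := by
    rw [szStructureOp_eq_waves]
    exact (Complex.nonneg_iff.mp
      ((Matrix.posSemidef_self_mul_conjTranspose (spinWaveZ L k)).dotProduct_mulVec_nonneg ψ)).1
  exact div_nonneg hnum (pow_nonneg (Nat.cast_nonneg L) 2)

/-- **`S_zz(q; ψ) ≤ S_s(q; ψ)`** for every `q`, `ψ` (`𝓢_s − 𝓢_zz = ½(T⁺T⁺ᴴ + T⁻T⁻ᴴ) ⪰ 0`). -/
theorem szStructureFactor_le_spinStructureFactor (k : TorusSite 2 L) (ψ : Fock (Orb (FermionTorus 2 L))) :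
    szStructureFactor L k ψ ≤ spinStructureFactor L k ψ := by
  open scoped ComplexOrder in
  have ha := (Complex.nonneg_iff.mp
    ((Matrix.posSemidef_self_mul_conjTranspose (spinWavePlus L k)).dotProduct_mulVec_nonneg ψ)).1
  open scoped ComplexOrder in
  have hb := (Complex.nonneg_iff.mp
    ((Matrix.posSemidef_self_mul_conjTranspose (spinWaveMinus L k)).dotProduct_mulVec_nonneg ψ)).1
  have hhalf : (1 / 2 : ℂ) = ((1 / 2 : ℝ) : ℂ) := by norm_num
  have hre : (expect (spinStructureOp L k) ψ).re =
      (1 / 2 : ℝ) * ((star ψ ⬝ᵥ ((spinWavePlus L k * (spinWavePlus L k)ᴴ) *ᵥ ψ)).re +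
          (star ψ ⬝ᵥ ((spinWaveMinus L k * (spinWaveMinus L k)ᴴ) *ᵥ ψ)).re) +
        (expect (szStructureOp L k) ψ).re := by
    rw [spinStructureOp_eq_pm_add_sz, expect_add, expect_smul, expect_add, Complex.add_re, hhalf,
      Complex.re_ofReal_mul, Complex.add_re]
    rfl
  unfold szStructureFactor spinStructureFactor
  refine div_le_div_of_nonneg_right ?_ (pow_nonneg (Nat.cast_nonneg L) 2)
  rw [hre]
  nlinarith [ha, hb]

end Torus

/-! ## Translation averaging: `C_zz(r; ψ) = Re ω̄_ψ(Sᶻ_0 Sᶻ_r)` -/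

section Translation

variable {L : ℕ} [NeZero L]

/-- (Local to this section, as in `HubbardNNNHoppingPairCorrelatorCertificate`: one `DecidableEq` path
for the orbital-generic relabelling lemmas; without it `map_sum` below times out in instance search.) -/
local instance (priority := high) instDecidableEqFermionTorusSz : DecidableEq (FermionTorus 2 L) :=
  LinearOrder.toDecidableEq

/-- `T_v Sᶻ_x = Sᶻ_{x+v}`. -/
theorem relabel_translate_fermionSpinZ (v x : TorusSite 2 L) :
    relabel (Orb.translate v) (fermionSpinZ (ofTorusSite x)) = fermionSpinZ (ofTorusSite (x + v)) := by
  rw [Orb.translate, relabel_mapEquiv_fermionSpinZ, ofTorusEquiv_ofTorusSite, Equiv.coe_addRight]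

/-- **`Σ_w U_w (Sᶻ_0 Sᶻ_r) U_wᴴ = W^z_r`**. -/
theorem sum_conj_fockTranslate_fermionSpinZ_mul (r : TorusSite 2 L) :
    ∑ w : TorusSite 2 L, (fockTranslate w).val * (fermionSpinZ (ofTorusSite 0) * fermionSpinZ (ofTorusSite r)) *
        (fockTranslate w).valᴴ = szCorrSum L r := by
  unfold szCorrSum
  refine Finset.sum_congr rfl fun w _ => ?_
  rw [← relabel_eq_fockRelabel_conj, relabel_mul, relabel_translate_fermionSpinZ, relabel_translate_fermionSpinZ,
    zero_add, add_comm r w]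

/-- **`⟨ψ, W^z_r ψ⟩ = L² · ω̄_ψ(Sᶻ_0 Sᶻ_r)`**, `ω̄_ψ = orbitState (spaceGroupUnitary {1}) ψ`. -/
theorem expect_szCorrSum_eq_card_mul_orbitState (r : TorusSite 2 L) (ψ : Fock (Orb (FermionTorus 2 L))) :
    expect (szCorrSum L r) ψ =
      ((L ^ 2 : ℕ) : ℂ) * orbitState (spaceGroupUnitary ({1} : Finset (DihedralGroup 4))) ψ
        (fermionSpinZ (ofTorusSite 0) * fermionSpinZ (ofTorusSite r)) := by
  rw [Literature.MathematicalPhysics.QuantumLattice.expect, ← sum_conj_fockTranslate_fermionSpinZ_mul,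
    ← sum_spaceGroupUnitary_singleton_one_conj,
    star_dotProduct_sum_spaceGroup_conj_mulVec (Finset.mem_singleton_self _)]
  rw [Finset.card_singleton]
  push_cast
  ring

/-- **`C_zz(r; ψ) = Re ω̄_ψ(Sᶻ_0 Sᶻ_r)`**. -/
theorem szCorr_eq_re_orbitState (r : TorusSite 2 L) (ψ : Fock (Orb (FermionTorus 2 L))) :
    szCorr L r ψ =
      (orbitState (spaceGroupUnitary ({1} : Finset (DihedralGroup 4))) ψ
        (fermionSpinZ (ofTorusSite 0) * fermionSpinZ (ofTorusSite r))).re := by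
  have hL : ((L : ℝ)) ^ 2 ≠ 0 := pow_ne_zero 2 (Nat.cast_ne_zero.2 (NeZero.ne L))
  unfold szCorr
  rw [expect_szCorrSum_eq_card_mul_orbitState]
  have hc : ((L ^ 2 : ℕ) : ℂ) = ((((L : ℝ)) ^ 2 : ℝ) : ℂ) := by push_cast; ring
  rw [hc, Complex.re_ofReal_mul, mul_div_cancel_left₀ _ hL]

omit [NeZero L] in
/-- `0 mod L = 0`. -/
private theorem proj_zero_site' : Torus.proj L (0 : Site 2) = 0 := by
  funext i; simp [Torus.proj]

/-- **Window-objective reading**: `Re ω̄_ψ(Γ(ι_{Λ',L}) (Σ_j w_j Sᶻ_0 Sᶻ_{r_j})) = Σ_j w_j C_zz(r_j mod L; ψ)`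
(window operators `sZAt`). -/
theorem re_orbitState_toTorusEmb_sum_sZAt_mul {Λ' : Finset (Site 2)}
    (hInj' : Set.InjOn (Torus.proj (d := 2) L) ↑Λ') (hz : (0 : Site 2) ∈ Λ')
    {ι : Type*} (R : Finset ι) (w : ι → ℝ) (rv : ι → Site 2) (hr : ∀ j, rv j ∈ Λ')
    (ψ : Fock (Orb (FermionTorus 2 L))) :
    (orbitState (spaceGroupUnitary ({1} : Finset (DihedralGroup 4))) ψ
        (fermionEmbed (PolySite.toTorusEmb L hInj')
          (∑ j ∈ R, ((w j : ℝ) : ℂ) • (sZAt 0 hz * sZAt (rv j) (hr j))))).re =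
      ∑ j ∈ R, w j * szCorr L (Torus.proj L (rv j)) ψ := by
  simp only [map_sum, map_smul, map_mul, sZAt, fermionEmbed_fermionSpinZ, PolySite.toTorusEmb_pt,
    proj_zero_site', smul_eq_mul, Complex.re_sum, Complex.re_ofReal_mul, szCorr_eq_re_orbitState]

end Translation

end Summit.Ventures.CertifiedManyBodySolver.Observables
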